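import Summits.Parity.BatemanHorn.Theses.RoughValueTransport
import Summits.Parity.BatemanHorn.Theorems.RoughValueTransportRoughValueLawRieszProductLimit
import Literature.NumberTheory.LFunctions.PolynomialRootMoebiusSharpCutoff
import Literature.NumberTheory.Sieve.BatemanHornProofs
import HarnessLib

/-!
# Line `friable-deep-tail` (crux `RoughValueLaw`, stmt-Parity-11390): the order-`k` Riesz mean of
the truncated singular series from the two v7 stubs (composition, sorry-free)

For a Bateman–Horn system `f = (f₀,…,f_{k−1})` put `ρ_f(d⃗) = #{r < ∏dᵢ : ∀ i, dᵢ ∣ fᵢ(r)}` and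
`R_f(D) = Σ_{1 ≤ dᵢ ≤ D, ∏dᵢ ≤ D} μ(d⃗)ρ_f(d⃗)/∏dᵢ · log(D/∏dᵢ)^k` (the order-`k` log-Riesz mean of
the hyperbolically truncated singular series; skeleton `Lines/friable_deep_tail.lean`,
`rieszSingularSum`).  The v7 skeleton splits the v6 stub S2b₂ (`R_f(D)` converges, `k ≥ 2`) into

* (α) `stub_rieszProductLimit` — pure analysis: if `k` real arithmetic functions `aᵢ` have convergent
  order-1 log-Riesz means of `aᵢ(n)/n` and sharp cut-offs `|Σ_{n≤x} aᵢ(n)/n| ≤ C/log²x`, then the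
  order-`k` log-Riesz mean of their Dirichlet product converges;
* (β) `stub_singularSeriesFactorisation` — arithmetic: the joint coefficient
  `A_f(n) = Σ_{∏dᵢ = n} μ(d⃗)ρ_f(d⃗)` factors as `(∏ᵢ μρ_{fᵢ}) ⋆ E` with `Σ|E(m)|/m < ∞`.

This file proves, SORRY-FREE, the composition `(α) → (β) → R_f(D) converges` for every `k` and every
Bateman–Horn system (`rieszSingularSeries_of_factorisation`; conclusion = the registered v6
signature of S2b₂ without the `2 ≤ k` guard): regroup the tuple sum by the product
(`RieszFactorisation.tupleSum_eq_sum_fiber`), reorder the Dirichlet convolution under the cut-off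
(the landed `RieszProductLimit.sum_Icc_sum_divisorsAntidiagonal'`), instantiate (α) at
`aᵢ = μρ_{fᵢ}` using the tree's PROVED Landau theorems
(`exists_tendsto_logRieszMean_moebius_rootCount`, `abs_sum_moebius_rootCount_div_le`), bound the
convergent Riesz mean (the landed `RieszProductLimit.exists_bound_of_tendsto_rieszMean'`) and pass to
the limit with Tannery's theorem (`RieszFactorisation.tendsto_sum_div_mul_apply_div`):
`R_f(D) = Σ_{m ≤ D} E(m)/m · G(D/m) → M · Σ_m E(m)/m`.  Since (α) is LANDED
(`stub_rieszProductLimit`, p99246, imported), the corollary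
`rieszSingularSeries_of_singularSeriesFactorisation` discharges it: downstream only (β) is needed.

No new definitions (the single-coordinate function is written with Mathlib's
`toArithmeticFunction`).  Mathlib: `Finset.sum_fiberwise_of_maps_to`, `Finset.sum_bij'`,
`tendsto_tsum_of_dominated_convergence`, `Nat.floor_div_natCast`.  (rev 2: duplicates of the
sibling file's `sum_Icc_sum_divisorsAntidiagonal'` / `exists_bound_of_tendsto_rieszMean'` removed and
reused, per review of p99489.)
-/

noncomputable section

open Filter Finset Polynomial
open scoped Topology BigOperators

namespace Summit.Parity.BatemanHorn.Cruxes.RoughValueLaw.FriableDeepTail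

open Literature.NumberTheory.Sieve

namespace RieszFactorisation

/-- **Regrouping the tuple sum by the product.**  For `1 ≤ dᵢ ≤ D`, `∏dᵢ ≤ D`:
`Σ_{d⃗} μ(d⃗)·#{r < ∏dᵢ : ∀ i, dᵢ ∣ fᵢ(r)}/∏dᵢ·log(D/∏dᵢ)^k
 = Σ_{1 ≤ n ≤ D} (Σ_{dᵢ ∣ n, ∏dᵢ = n} μ(d⃗)·#{r < n : …})/n · log(D/n)^k`. [folklore] -/
theorem tupleSum_eq_sum_fiber {k : ℕ} (f : Fin k → ℤ[X]) (D : ℕ) :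
    ∑ d ∈ (Fintype.piFinset fun _ : Fin k => Icc 1 D) with (∏ i, d i) ≤ D,
        (∏ i, (ArithmeticFunction.moebius (d i) : ℝ)) *
            ((#((range (∏ i, d i)).filter
                (fun r : ℕ => ∀ i, ((d i : ℕ) : ℤ) ∣ (f i).eval (r : ℤ))) : ℕ) : ℝ) /
            (∏ i, ((d i : ℕ) : ℝ)) *
          Real.log ((D : ℝ) / ((∏ i, d i : ℕ) : ℝ)) ^ k =
      ∑ n ∈ Icc 1 D,
        (∑ d ∈ (Fintype.piFinset fun _ : Fin k => n.divisors) with (∏ i, d i) = n,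
            (∏ i, (ArithmeticFunction.moebius (d i) : ℝ)) *
              ((#((range n).filter
                  (fun r : ℕ => ∀ i, ((d i : ℕ) : ℤ) ∣ (f i).eval (r : ℤ))) : ℕ) : ℝ)) / n *
          Real.log ((D : ℝ) / n) ^ k := by
  rw [← Finset.sum_fiberwise_of_maps_to (g := fun d : Fin k → ℕ => ∏ i, d i) (t := Icc 1 D)
    (fun d hd => by
      rw [Finset.mem_filter, Fintype.mem_piFinset] at hd
      exact mem_Icc.mpr ⟨Finset.one_le_prod' fun i _ => (mem_Icc.mp (hd.1 i)).1, hd.2⟩)]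
  refine Finset.sum_congr rfl fun n hn => ?_
  obtain ⟨hn1, hnD⟩ := mem_Icc.mp hn
  have hn0 : n ≠ 0 := by omega
  have hfib : ((Fintype.piFinset fun _ : Fin k => Icc 1 D).filter
        (fun d : Fin k → ℕ => (∏ i, d i) ≤ D)).filter (fun d => (∏ i, d i) = n) =
      (Fintype.piFinset fun _ : Fin k => n.divisors).filter (fun d => (∏ i, d i) = n) := by
    ext d
    simp only [mem_filter, Fintype.mem_piFinset, mem_Icc, Nat.mem_divisors]
    constructor
    · rintro ⟨⟨_, _⟩, hprod⟩
      exact ⟨fun i => ⟨hprod ▸ Finset.dvd_prod_of_mem d (mem_univ i), hn0⟩, hprod⟩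
    · rintro ⟨hd, hprod⟩
      refine ⟨⟨fun i => ⟨Nat.pos_of_dvd_of_pos (hd i).1 (by omega), ?_⟩, hprod.le.trans hnD⟩, hprod⟩
      exact (Nat.le_of_dvd (by omega) (hd i).1).trans hnD
  rw [hfib, Finset.sum_div, Finset.sum_mul]
  refine Finset.sum_congr rfl fun d hd => ?_
  have hprod : (∏ i, d i) = n := (mem_filter.mp hd).2
  rw [show (∏ i, ((d i : ℕ) : ℝ)) = (n : ℝ) by rw [← Nat.cast_prod, hprod], hprod]

/-- **Tannery's theorem for `Σ_{m ≤ D} E(m)/m·G(D/m)`.**  If `Σ|E(m)|/m < ∞`, `G → M` at `+∞` and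
`|G| ≤ K`, then `Σ_{1 ≤ m ≤ D} E(m)/m · G(D/m) → M · Σ_m E(m)/m` (`D → ∞` through `ℕ`). [folklore] -/
theorem tendsto_sum_div_mul_apply_div {E : ℕ → ℝ} (hE : Summable fun m : ℕ => |E m| / m)
    {G : ℝ → ℝ} {M K : ℝ} (hG : Tendsto G atTop (𝓝 M)) (hK : ∀ y, |G y| ≤ K) :
    Tendsto (fun D : ℕ => ∑ m ∈ Icc 1 D, E m / m * G ((D : ℝ) / m)) atTop
      (𝓝 (M * ∑' m, E m / m)) := by
  have hK0 : 0 ≤ K := (abs_nonneg _).trans (hK 0)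
  -- the summands, extended by zero
  set F : ℕ → ℕ → ℝ := fun D m => if m ∈ Icc 1 D then E m / m * G ((D : ℝ) / m) else 0 with hF
  have hsumF : ∀ D : ℕ, ∑ m ∈ Icc 1 D, E m / m * G ((D : ℝ) / m) = ∑' m, F D m := by
    intro D
    rw [tsum_eq_sum (s := Icc 1 D) (fun m hm => by simp only [hF]; rw [if_neg hm])]
    exact Finset.sum_congr rfl fun m hm => by simp only [hF]; rw [if_pos hm]
  simp_rw [hsumF]
  have hlim : M * ∑' m, E m / m = ∑' m, E m / m * M := by rw [tsum_mul_right, mul_comm]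
  rw [hlim]
  refine tendsto_tsum_of_dominated_convergence (bound := fun m => |E m| / m * K) (hE.mul_right K)
    ?_ ?_
  · intro m
    rcases Nat.eq_zero_or_pos m with rfl | hm
    · have : ∀ D, F D 0 = 0 := fun D => by simp [hF]
      simp only [this, Nat.cast_zero, div_zero, zero_mul]
      exact tendsto_const_nhds
    · have hev : ∀ᶠ D : ℕ in atTop, F D m = E m / m * G ((D : ℝ) / m) := by
        filter_upwards [eventually_ge_atTop m] with D hD
        simp [hF, hD, Nat.one_le_iff_ne_zero.mpr hm.ne']
      refine Tendsto.congr' (EventuallyEq.symm hev) ?_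
      refine Tendsto.const_mul _ (hG.comp ?_)
      exact Tendsto.atTop_div_const (by exact_mod_cast hm) tendsto_natCast_atTop_atTop
  · refine Eventually.of_forall fun D m => ?_
    simp only [hF]
    split_ifs with hm
    · rw [Real.norm_eq_abs, abs_mul, abs_div, Nat.abs_cast]
      exact mul_le_mul_of_nonneg_left (hK _) (by positivity)
    · rw [norm_zero]; positivity

/-- The single-coordinate function `n ↦ μ(n)ρ_g(n)` written with Mathlib's `toArithmeticFunction`
agrees with `μ(n)·polyRootCountMod ![g] n` off `0`. [folklore] -/
theorem toArithmeticFunction_muRho_apply (g : ℤ[X]) {n : ℕ} (hn : n ≠ 0) :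
    toArithmeticFunction (fun m : ℕ => (ArithmeticFunction.moebius m : ℝ) *
        (polyRootCountMod ![g] m : ℝ)) n =
      (ArithmeticFunction.moebius n : ℝ) * (polyRootCountMod ![g] n : ℝ) := by
  simp [toArithmeticFunction, hn]

end RieszFactorisation

open RieszFactorisation in
/-- **The order-`k` log-Riesz mean of the truncated singular series of a Bateman–Horn system
converges, GIVEN the two v7 stubs of line `friable-deep-tail`** — (α) `stub_rieszProductLimit`
(first hypothesis, verbatim) and (β) `stub_singularSeriesFactorisation` (second hypothesis,
verbatim); the conclusion is the registered v6 stub S2b₂ `stub_rieszSingularSeries` for EVERY `k`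
(no `2 ≤ k` guard).  Proof: `R_f(D) = Σ_{m ≤ D} E(m)/m · G(D/m)` with `G` the order-`k` Riesz mean
of `∏ᵢ μρ_{fᵢ}`, `G → M` by (α) at `aᵢ = μρ_{fᵢ}` (hypotheses from the tree's Landau theorems
`exists_tendsto_logRieszMean_moebius_rootCount`, `abs_sum_moebius_rootCount_div_le`), `G` bounded,
Tannery. -/
theorem rieszSingularSeries_of_factorisation :
    (∀ (k : ℕ) (a : Fin k → ArithmeticFunction ℝ),
      (∀ i, ∃ L : ℝ, Tendsto (fun x : ℝ => ∑ n ∈ Icc 1 ⌊x⌋₊, a i n / n * Real.log (x / n))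
        atTop (𝓝 L)) →
      (∀ i, ∃ C : ℝ, ∀ x : ℝ, 2 ≤ x → |∑ n ∈ Icc 1 ⌊x⌋₊, a i n / n| ≤ C / Real.log x ^ 2) →
      ∃ M : ℝ, Tendsto (fun x : ℝ => ∑ n ∈ Icc 1 ⌊x⌋₊, (∏ i, a i) n / n * Real.log (x / n) ^ k)
        atTop (𝓝 M)) →
    (∀ (k : ℕ) (f : Fin k → ℤ[X]), IsBatemanHornSystem f →
      ∃ E : ℕ → ℝ, Summable (fun m : ℕ => |E m| / m) ∧
        ∀ n : ℕ, (∑ d ∈ (Fintype.piFinset fun _ : Fin k => n.divisors) with (∏ i, d i) = n,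
            (∏ i, (ArithmeticFunction.moebius (d i) : ℝ)) *
              ((#((range n).filter
                  (fun r : ℕ => ∀ i, ((d i : ℕ) : ℤ) ∣ (f i).eval (r : ℤ))) : ℕ) : ℝ)) =
          ∑ p ∈ n.divisorsAntidiagonal,
            (∏ i, toArithmeticFunction (fun m : ℕ => (ArithmeticFunction.moebius m : ℝ) *
                (polyRootCountMod ![f i] m : ℝ))) p.1 * E p.2) →
    ∀ (k : ℕ) (f : Fin k → ℤ[X]), IsBatemanHornSystem f →
      ∃ M : ℝ, Tendsto (fun D : ℕ =>
        ∑ d ∈ (Fintype.piFinset fun _ : Fin k => Icc 1 D) with (∏ i, d i) ≤ D,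
          (∏ i, (ArithmeticFunction.moebius (d i) : ℝ)) *
              ((#((range (∏ i, d i)).filter
                  (fun r : ℕ => ∀ i, ((d i : ℕ) : ℤ) ∣ (f i).eval (r : ℤ))) : ℕ) : ℝ) /
              (∏ i, ((d i : ℕ) : ℝ)) *
            Real.log ((D : ℝ) / ((∏ i, d i : ℕ) : ℝ)) ^ k) atTop (𝓝 M) := by
  intro hα hβ k f hf
  obtain ⟨E, hEsum, hEid⟩ := hβ k f hf
  -- the single-coordinate functions and (α) at `aᵢ = μρ_{fᵢ}`
  set a : Fin k → ArithmeticFunction ℝ := fun i => toArithmeticFunction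
    (fun m : ℕ => (ArithmeticFunction.moebius m : ℝ) * (polyRootCountMod ![f i] m : ℝ)) with ha
  have H1 : ∀ i, ∃ L : ℝ, Tendsto (fun x : ℝ => ∑ n ∈ Icc 1 ⌊x⌋₊,
      a i n / n * Real.log (x / n)) atTop (𝓝 L) := by
    intro i
    obtain ⟨L, hL⟩ := Literature.NumberTheory.LFunctions.exists_tendsto_logRieszMean_moebius_rootCount
      (hf.irreducible i) (hf.natDegree_pos i)
    refine ⟨L, hL.congr fun x => Finset.sum_congr rfl fun n hn => ?_⟩
    rw [ha, toArithmeticFunction_muRho_apply (f i) (by have := (mem_Icc.mp hn).1; omega)]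
  have H2 : ∀ i, ∃ C : ℝ, ∀ x : ℝ, 2 ≤ x →
      |∑ n ∈ Icc 1 ⌊x⌋₊, a i n / n| ≤ C / Real.log x ^ 2 := by
    intro i
    obtain ⟨C, hC⟩ := Literature.NumberTheory.LFunctions.abs_sum_moebius_rootCount_div_le
      (hf.irreducible i) (hf.natDegree_pos i)
    refine ⟨C, fun x hx => ?_⟩
    have h := hC x hx
    rwa [Finset.sum_congr rfl fun n hn => by
      rw [ha, toArithmeticFunction_muRho_apply (f i) (by have := (mem_Icc.mp hn).1; omega)]]
  obtain ⟨M, hM⟩ := hα k a H1 H2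
  set B : ArithmeticFunction ℝ := ∏ i, a i with hB
  set G : ℝ → ℝ := fun y => ∑ l ∈ Icc 1 ⌊y⌋₊, B l / l * Real.log (y / l) ^ k with hGdef
  have hG : Tendsto G atTop (𝓝 M) := hM
  obtain ⟨K, hK⟩ := RieszProductLimit.exists_bound_of_tendsto_rieszMean' B k hM
  refine ⟨M * ∑' m, E m / m, ?_⟩
  have hT := tendsto_sum_div_mul_apply_div hEsum hG hK
  refine hT.congr fun D => ?_
  symm
  rw [tupleSum_eq_sum_fiber]
  calc ∑ n ∈ Icc 1 D,
        (∑ d ∈ (Fintype.piFinset fun _ : Fin k => n.divisors) with (∏ i, d i) = n,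
            (∏ i, (ArithmeticFunction.moebius (d i) : ℝ)) *
              ((#((range n).filter
                  (fun r : ℕ => ∀ i, ((d i : ℕ) : ℤ) ∣ (f i).eval (r : ℤ))) : ℕ) : ℝ)) / n *
          Real.log ((D : ℝ) / n) ^ k
      = ∑ n ∈ Icc 1 D, ∑ p ∈ n.divisorsAntidiagonal,
          E p.2 / p.2 * (B p.1 / p.1 * Real.log ((D : ℝ) / p.2 / p.1) ^ k) := by
        refine Finset.sum_congr rfl fun n hn => ?_
        rw [hEid n, Finset.sum_div, Finset.sum_mul]
        refine Finset.sum_congr rfl fun p hp => ?_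
        obtain ⟨hpn, hn0⟩ := Nat.mem_divisorsAntidiagonal.mp hp
        have h1 : (p.1 : ℝ) ≠ 0 := by exact_mod_cast (Nat.mul_ne_zero_iff.mp (hpn ▸ hn0)).1
        have h2 : (p.2 : ℝ) ≠ 0 := by exact_mod_cast (Nat.mul_ne_zero_iff.mp (hpn ▸ hn0)).2
        rw [← hpn, Nat.cast_mul, div_div, mul_comm (p.2 : ℝ)]
        field_simp
    _ = ∑ m ∈ Icc 1 D, ∑ l ∈ Icc 1 (D / m),
          E m / m * (B l / l * Real.log ((D : ℝ) / m / l) ^ k) :=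
        RieszProductLimit.sum_Icc_sum_divisorsAntidiagonal'
          (fun l m => E m / m * (B l / l * Real.log ((D : ℝ) / m / l) ^ k)) D
    _ = ∑ m ∈ Icc 1 D, E m / m * G ((D : ℝ) / m) := by
        refine Finset.sum_congr rfl fun m hm => ?_
        rw [← Finset.mul_sum, hGdef]
        simp only
        rw [Nat.floor_div_natCast, Nat.floor_natCast]

/-- **Corollary ((α) discharged).**  With the LANDED `stub_rieszProductLimit` (p99246) the order-`k`
Riesz mean of the truncated singular series converges for every `k` and every Bateman–Horn system
GIVEN ONLY the factorisation stub (β) `stub_singularSeriesFactorisation`. -/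
theorem rieszSingularSeries_of_singularSeriesFactorisation
    (hβ : ∀ (k : ℕ) (f : Fin k → ℤ[X]), IsBatemanHornSystem f →
      ∃ E : ℕ → ℝ, Summable (fun m : ℕ => |E m| / m) ∧
        ∀ n : ℕ, (∑ d ∈ (Fintype.piFinset fun _ : Fin k => n.divisors) with (∏ i, d i) = n,
            (∏ i, (ArithmeticFunction.moebius (d i) : ℝ)) *
              ((#((range n).filter
                  (fun r : ℕ => ∀ i, ((d i : ℕ) : ℤ) ∣ (f i).eval (r : ℤ))) : ℕ) : ℝ)) =
          ∑ p ∈ n.divisorsAntidiagonal,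
            (∏ i, toArithmeticFunction (fun m : ℕ => (ArithmeticFunction.moebius m : ℝ) *
                (polyRootCountMod ![f i] m : ℝ))) p.1 * E p.2)
    (k : ℕ) (f : Fin k → ℤ[X]) (hf : IsBatemanHornSystem f) :
    ∃ M : ℝ, Tendsto (fun D : ℕ =>
      ∑ d ∈ (Fintype.piFinset fun _ : Fin k => Icc 1 D) with (∏ i, d i) ≤ D,
        (∏ i, (ArithmeticFunction.moebius (d i) : ℝ)) *
            ((#((range (∏ i, d i)).filter
                (fun r : ℕ => ∀ i, ((d i : ℕ) : ℤ) ∣ (f i).eval (r : ℤ))) : ℕ) : ℝ) /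
            (∏ i, ((d i : ℕ) : ℝ)) *
          Real.log ((D : ℝ) / ((∏ i, d i : ℕ) : ℝ)) ^ k) atTop (𝓝 M) :=
  rieszSingularSeries_of_factorisation stub_rieszProductLimit hβ k f hf

end Summit.Parity.BatemanHorn.Cruxes.RoughValueLaw.FriableDeepTail
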